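import Mathlib.Topology.MetricSpace.Cauchy
import Mathlib.Topology.Sequences
import Mathlib.Topology.UniformSpace.UniformConvergence
import Mathlib.Topology.MetricSpace.Pseudo.Lemmas
import HarnessLib

/-!
# Arzelà–Ascoli for sequences: uniformly convergent subsequences of equicontinuous sequences

The sequential form of the Arzelà–Ascoli theorem on a TOTALLY BOUNDED (not necessarily compact or
closed) subset `S` of a pseudo-metric space: a sequence of functions `f i : X → F` which is
uniformly equicontinuous on `S` and takes values (on `S`) in a fixed compact set `K` has a
subsequence converging UNIFORMLY on `S`.  (Mathlib's `BoundedContinuousFunction.arzela_ascoli`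
is the set-compactness form on a compact DOMAIN; the form here is the one used to extract limits
of functions given on open balls — e.g. White 2005, Thm. 8.1 — without first extending them to the
closed ball.)

Proof: a countable set `D ⊆ S` which is `1/(n+1)`-dense for every `n` (total boundedness);
sequential compactness of `K^D` (Tychonoff + first countability) gives a subsequence converging
on `D`; equicontinuity upgrades this to a uniform Cauchy condition on `S`; completeness of `K`
gives the limit.

## Main result

* `exists_subseq_tendstoUniformlyOn_of_equicontinuous`.

## References

* W. Rudin, *Principles of Mathematical Analysis* (3rd ed.), Thm. 7.23 (subsequence converging on
  a countable set) and Thm. 7.25 (Arzelà–Ascoli).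
* B. White, Ann. of Math. 161 (2005), §2.6 and Thm. 8.1 (use on parabolic balls).
-/

open Filter Set Metric Topology
open scoped Topology

namespace Literature.Analysis.FunctionSpaces

variable {X : Type*} [PseudoMetricSpace X] {F : Type*} [PseudoMetricSpace F]

/-- A totally bounded set has, for every `n`, a finite `1/(n+1)`-net INSIDE the set. [folklore] -/
theorem exists_finite_net_of_totallyBounded {S : Set X} (hS : TotallyBounded S) (n : ℕ) :
    ∃ t : Set X, t ⊆ S ∧ t.Finite ∧ ∀ x ∈ S, ∃ y ∈ t, dist x y < 1 / (n + 1 : ℝ) := by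
  obtain ⟨t, htS, htf, hcov⟩ :=
    (totallyBounded_iff_subset.1 hS) _ (dist_mem_uniformity (by positivity : (0 : ℝ) < 1 / (n + 1)))
  refine ⟨t, htS, htf, fun x hx => ?_⟩
  obtain ⟨y, hy, hxy⟩ := mem_iUnion₂.1 (hcov hx)
  exact ⟨y, hy, hxy⟩

omit [PseudoMetricSpace X] in
/-- **Subsequence converging on a countable set** (Rudin, Thm. 7.23): a sequence of functions with
values in a compact set `K` on a countable set `D` has a subsequence converging at every point of
`D`. [folklore] -/
theorem exists_subseq_tendsto_on_countable {D : Set X} (hD : D.Countable) {K : Set F}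
    (hK : IsCompact K) (f : ℕ → X → F) (hfK : ∀ i, ∀ x ∈ D, f i x ∈ K) :
    ∃ φ : ℕ → ℕ, StrictMono φ ∧ ∀ x ∈ D, ∃ y ∈ K, Tendsto (fun i => f (φ i) x) atTop (𝓝 y) := by
  haveI : Countable D := hD.to_subtype
  -- the sequence in the compact, first countable space `K^D`
  let v : ℕ → (D → F) := fun i d => f i d
  have hv : ∀ i, v i ∈ Set.pi univ (fun _ : D => K) := fun i d _ => hfK i d d.2
  obtain ⟨w, hw, φ, hφ, hlim⟩ := (isCompact_univ_pi fun _ : D => hK).isSeqCompact hv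
  refine ⟨φ, hφ, fun x hx => ⟨w ⟨x, hx⟩, hw ⟨x, hx⟩ (mem_univ _), ?_⟩⟩
  exact (continuous_apply (⟨x, hx⟩ : D)).continuousAt.tendsto.comp hlim

/-- **Arzelà–Ascoli, sequential form on a totally bounded set.**  Let `S ⊆ X` be totally bounded and
`f i : X → F` (`i : ℕ`) uniformly equicontinuous on `S` with values in a compact set `K`.  Then a
subsequence converges uniformly on `S`. (Rudin, Thm. 7.25, in the form needed for functions given
on open balls.) [folklore] -/
theorem exists_subseq_tendstoUniformlyOn_of_equicontinuous {S : Set X} (hS : TotallyBounded S)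
    {K : Set F} (hK : IsCompact K) (f : ℕ → X → F) (hfK : ∀ i, ∀ x ∈ S, f i x ∈ K)
    (hequi : ∀ ε > (0 : ℝ), ∃ δ > (0 : ℝ), ∀ i, ∀ x ∈ S, ∀ y ∈ S,
      dist x y < δ → dist (f i x) (f i y) ≤ ε) :
    ∃ φ : ℕ → ℕ, StrictMono φ ∧ ∃ g : X → F, TendstoUniformlyOn (fun i => f (φ i)) g atTop S := by
  classical
  -- a countable subset of `S` that is `1/(n+1)`-dense for every `n`
  choose t htS htf hnet using exists_finite_net_of_totallyBounded hS
  set D : Set X := ⋃ n, t n with hD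
  have hDS : D ⊆ S := iUnion_subset htS
  have hDc : D.Countable := countable_iUnion fun n => (htf n).countable
  -- a subsequence converging on `D`
  obtain ⟨φ, hφ, hconv⟩ :=
    exists_subseq_tendsto_on_countable hDc hK f fun i x hx => hfK i x (hDS hx)
  refine ⟨φ, hφ, ?_⟩
  -- uniform Cauchy on `S`
  have hCauchy : UniformCauchySeqOn (fun i => f (φ i)) atTop S := by
    rw [Metric.uniformCauchySeqOn_iff]
    intro ε hε
    obtain ⟨δ, hδ, hδequi⟩ := hequi (ε / 3) (by positivity)
    obtain ⟨n, hn⟩ := exists_nat_one_div_lt hδ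
    -- the finitely many net points `t n` converge, hence are uniformly Cauchy
    have hfin : ∀ y ∈ t n, ∃ N, ∀ m ≥ N, ∀ k ≥ N, dist (f (φ m) y) (f (φ k) y) < ε / 3 := by
      intro y hy
      obtain ⟨z, -, hz⟩ := hconv y (mem_iUnion.2 ⟨n, hy⟩)
      have hc : CauchySeq fun i => f (φ i) y := hz.cauchySeq
      rw [Metric.cauchySeq_iff] at hc
      obtain ⟨N, hN⟩ := hc (ε / 3) (by positivity)
      exact ⟨N, fun m hm k hk => hN m hm k hk⟩
    choose! N hN using hfin
    refine ⟨(htf n).toFinset.sup N, fun m hm k hk x hx => ?_⟩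
    obtain ⟨y, hy, hxy⟩ := hnet n x hx
    have hNy : N y ≤ (htf n).toFinset.sup N := Finset.le_sup ((htf n).mem_toFinset.2 hy)
    have h1 : dist (f (φ m) x) (f (φ m) y) ≤ ε / 3 := hδequi _ x hx y (htS n hy) (hxy.trans hn)
    have h2 : dist (f (φ k) x) (f (φ k) y) ≤ ε / 3 := hδequi _ x hx y (htS n hy) (hxy.trans hn)
    have h3 : dist (f (φ m) y) (f (φ k) y) < ε / 3 := hN y hy m (hNy.trans hm) k (hNy.trans hk)
    calc dist (f (φ m) x) (f (φ k) x)
        ≤ dist (f (φ m) x) (f (φ m) y) + dist (f (φ m) y) (f (φ k) y) +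
          dist (f (φ k) y) (f (φ k) x) := dist_triangle4 _ _ _ _
      _ < ε / 3 + ε / 3 + ε / 3 := by rw [dist_comm (f (φ k) y)]; linarith
      _ = ε := by ring
  -- pointwise limits exist in the complete set `K`
  have hpt : ∀ x ∈ S, ∃ y, Tendsto (fun i => f (φ i) x) atTop (𝓝 y) := by
    intro x hx
    have hc : CauchySeq fun i => f (φ i) x := hCauchy.cauchySeq hx
    obtain ⟨y, -, hy⟩ := cauchySeq_tendsto_of_isComplete hK.isComplete (fun i => hfK _ x hx) hc
    exact ⟨y, hy⟩
  by_cases hSe : S.Nonempty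
  · haveI : Nonempty F := ⟨f 0 hSe.some⟩
    choose! g hg using hpt
    exact ⟨g, hCauchy.tendstoUniformlyOn_of_tendsto hg⟩
  · rw [not_nonempty_iff_eq_empty] at hSe
    exact ⟨f 0, by simp [hSe, tendstoUniformlyOn_empty]⟩

end Literature.Analysis.FunctionSpaces
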